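import Mathlib
import Literature.NumberTheory.Automorphic.HilbertModularFormQExpansion
import Summits.Langlands.Langlands.Theorems.CapacityClassicalityHilbertIntegralOverconvergentIsCongruenceKoecherGlue
import Summits.Langlands.Langlands.Theorems.CapacityClassicalityHilbertIntegralOverconvergentIsCongruenceStubTotallyRealEmbeddings
import Summits.Langlands.Langlands.Theorems.CapacityClassicalityHilbertIntegralOverconvergentIsCongruenceStubDualLatticeEquiv
import Summits.Langlands.Langlands.Theorems.CapacityClassicalityHilbertIntegralOverconvergentIsCongruenceStubContDiffCube
import Summits.Langlands.Langlands.Theorems.CapacityClassicalityHilbertIntegralOverconvergentIsCongruenceStubHasSumCube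
import Summits.Langlands.Langlands.Theorems.CapacityClassicalityHilbertIntegralOverconvergentIsCongruenceStubPairingCubePoint
import Summits.Langlands.Langlands.Theorems.CapacityClassicalityHilbertIntegralOverconvergentIsCongruenceStubFourierCoeffAtIndep
import Summits.Langlands.Langlands.Theorems.CapacityClassicalityHilbertIntegralOverconvergentIsCongruenceStubBoundedOfCoeffSupport
import Summits.Langlands.Langlands.Theorems.CapacityClassicalityHilbertIntegralOverconvergentIsCongruenceKoecher

/-!
# The Fourier expansion on the tube domain and Götzky–Koecher ⇒ bounded at `∞` (section L endpoints)

Endpoints of RESHAPE 8 (section L) of line Sketch-ideate-r1-k1 for the crux `HilbertIntegralOverconvergentIsCongruence`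
(stmt-Langlands-8485), in the vocabulary `Literature.NumberTheory.Automorphic.HilbertModular`:

* `hasSum_fourierCoeff` — **Freitag, *Hilbert Modular Forms*, Ch. I Lemma 4.1**: for `F` totally real, a holomorphic
  `𝓞 F`-periodic `f` on `ℍ^{Hom(F,ℝ)}` is the sum of its Fourier series `∑_{ν ∈ 𝔡⁻¹} a_ν e^{2πi S(νz)}`,
  `a_ν = HilbertModular.fourierCoeff f ν`, with `∑ |a_ν| e^{-2π⟨ν, Im z⟩} < ∞` (composition of the landed stubs L1
  `stub_dualLatticeEquiv`, L2a `stub_contDiff_cube`, L2b `stub_hasSum_cube`, L3 `stub_pairing_cubePoint`, L4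
  `stub_fourierCoeffAt_indep`);
* `isBoundedAtInfty_of_unit_equivariant` — **Götzky–Koecher, Freitag I.4.9 with I.4.3**: for `[F:ℚ] ≥ 2`, holomorphic +
  `𝓞 F`-periodic + equivariant under the totally positive units of a finite-index subgroup (non-zero multipliers) ⇒
  `HilbertModular.IsBoundedAtInfty` (with L6 `stub_bounded_of_coeff_support`, L7 `stub_koecher_fourierCoeffAt_eq_zero`).
-/

set_option linter.dupNamespace false

noncomputable section

namespace Summit.Langlands.Langlands.Theorems.HilbertIntegralOverconvergentIsCongruence

open MeasureTheory Complex NumberField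
open Literature.NumberTheory.Automorphic Literature.NumberTheory.Automorphic.HilbertModular

variable {F : Type} [Field F] [NumberField F]

/-- A point of `ℍ` in cube coordinates: `z = x + iy` with `y = Im z` and `realPoint x = Re z` (the real points of
the integral basis fill `ℝ^{Hom(F,ℝ)}`, landed stub K-D). -/
theorem exists_cubePoint_eq [NumberField.IsTotallyReal F] (z : Point F) :
    ∃ x : Coord F, cubePoint x (fun σ ↦ (z σ).im) = z := by
  obtain ⟨x, hx⟩ := (stub_totallyReal_embeddings F).2
    fun σ ↦ (z σ).re
  refine ⟨x, funext fun σ ↦ ?_⟩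
  have hσ := congrFun hx σ
  simp only at hσ
  simp only [cubePoint, realPoint, hσ, Complex.re_add_im]

/-- Periodicity of `x ↦ f(x + iy)` under `ℤ^ι`, from the `𝓞 F`-periodicity of `f` on `ℍ`. -/
theorem cube_periodic (f : Point F → ℂ)
    (hper : ∀ (a : 𝓞 F) (z : Point F), z ∈ halfSpace F → f (fun σ ↦ z σ + ((σ (a : F) : ℝ) : ℂ)) = f z)
    {y : (F →+* ℝ) → ℝ} (hy : ∀ σ, 0 < y σ) (m : Module.Free.ChooseBasisIndex ℤ (𝓞 F) → ℤ) (x : Coord F) :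
    f (cubePoint (x + fun i ↦ (m i : ℝ)) y) = f (cubePoint x y) := by
  rw [koe_cubePoint_add_intCast]
  exact hper _ (cubePoint x y)
    (koe_cubePoint_mem_halfSpace x hy)

/-- **The Fourier expansion on the tube domain** (Freitag I.4.1): for `F` totally real, a holomorphic `𝓞 F`-periodic
`f` on `ℍ` satisfies `f(z) = ∑_{ν ∈ 𝔡⁻¹} a_ν e^{2πi S(νz)}` with `a_ν = fourierCoeff f ν`, and
`∑_ν |a_ν| e^{-2π⟨ν, Im z⟩} < ∞`. [cite: Freitag1990, Ch. I Lemma 4.1] -/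
theorem hasSum_fourierCoeff (F : Type) [Field F] [NumberField F] [NumberField.IsTotallyReal F]
    (f : Point F → ℂ) (hf : IsHolomorphicOn F f)
    (hper : ∀ (a : 𝓞 F) (z : Point F), z ∈ halfSpace F → f (fun σ ↦ z σ + ((σ (a : F) : ℝ) : ℂ)) = f z)
    (z : Point F) (hz : z ∈ halfSpace F) :
    HasSum (fun ν : {ν : F | ∀ a : 𝓞 F, ∃ n : ℤ, Algebra.trace ℚ F (ν * a) = n} ↦
      fourierCoeff f ν * cexp (2 * Real.pi * I * pairing (ν : F) z)) (f z) ∧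
    Summable (fun ν : {ν : F | ∀ a : 𝓞 F, ∃ n : ℤ, Algebra.trace ℚ F (ν * a) = n} ↦
      ‖fourierCoeff f ν‖ * Real.exp (-(2 * Real.pi * ∑ σ : F →+* ℝ, σ (ν : F) * (z σ).im))) := by
  -- cube coordinates of `z`
  set y : (F →+* ℝ) → ℝ := fun σ ↦ (z σ).im with hydef
  have hy : ∀ σ, 0 < y σ := fun σ ↦ hz σ
  obtain ⟨x₀, hx₀⟩ := exists_cubePoint_eq z
  -- the smooth periodic cube function and its expansion
  set g : Coord F → ℂ := fun x ↦ f (cubePoint x y) with hgdef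
  have hg : ContDiff ℝ (⊤ : ℕ∞) g := stub_contDiff_cube F f hf y hy
  have hgper : ∀ (m : Module.Free.ChooseBasisIndex ℤ (𝓞 F) → ℤ) (x : Coord F),
      g (x + fun i ↦ (m i : ℝ)) = g x := fun m x ↦ cube_periodic f hper hy m x
  obtain ⟨hsum, habs⟩ := stub_hasSum_cube g hg hgper x₀
  have hgx₀ : g x₀ = f z := congrArg f hx₀
  rw [hgx₀] at hsum
  -- the dual lattice `≃ ℤ^ι`
  obtain ⟨e, he⟩ := stub_dualLatticeEquiv F
  -- the coefficient at frequency `e ν` is `e^{-2π⟨ν,y⟩} a_ν`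
  set B : {ν : F | ∀ a : 𝓞 F, ∃ n : ℤ, Algebra.trace ℚ F (ν * a) = n} → ℝ :=
    fun ν ↦ ∑ σ : F →+* ℝ, σ (ν : F) * y σ with hBdef
  have hcoeff : ∀ ν : {ν : F | ∀ a : 𝓞 F, ∃ n : ℤ, Algebra.trace ℚ F (ν * a) = n},
      (∫ x in Set.Icc (0 : Coord F) 1, g x * cexp (-(2 * Real.pi * I * (∑ i, (e ν i : ℝ) * x i : ℝ)))) =
        cexp (-(2 * Real.pi * B ν)) * fourierCoeff f ν := by
    intro ν
    have hphase : ∀ x : Coord F, pairing (ν : F) (cubePoint x y) =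
        ((∑ i, (e ν i : ℝ) * x i : ℝ) : ℂ) + ((B ν : ℝ) : ℂ) * I := fun x ↦ stub_pairing_cubePoint F ν (e ν) (he ν) x y
    have hAt : fourierCoeffAt f ν y =
        cexp (2 * Real.pi * B ν) *
          ∫ x in Set.Icc (0 : Coord F) 1, g x * cexp (-(2 * Real.pi * I * (∑ i, (e ν i : ℝ) * x i : ℝ))) := by
      rw [fourierCoeffAt, ← integral_const_mul]
      refine setIntegral_congr_fun measurableSet_Icc fun x _ ↦ ?_
      rw [hphase x]
      have : -(2 * Real.pi * I * (((∑ i, (e ν i : ℝ) * x i : ℝ) : ℂ) + ((B ν : ℝ) : ℂ) * I)) =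
          -(2 * Real.pi * I * ((∑ i, (e ν i : ℝ) * x i : ℝ) : ℂ)) + (2 * Real.pi * B ν : ℂ) := by
        ring_nf
        rw [Complex.I_sq]
        ring
      rw [this, Complex.exp_add]
      simp only [hgdef]
      ring
    have hindep : fourierCoeffAt f ν y = fourierCoeff f ν := by
      rw [fourierCoeff_eq]
      exact stub_fourierCoeffAt_indep F f hf hper ν ν.2 y (fun _ ↦ 1) hy fun _ ↦ one_pos
    rw [← hindep, hAt, ← mul_assoc, ← Complex.exp_add]
    have : -(2 * Real.pi * (B ν : ℂ)) + 2 * Real.pi * B ν = 0 := by ring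
    rw [this, Complex.exp_zero, one_mul]
  -- the phase at `z`
  have hphase₀ : ∀ ν : {ν : F | ∀ a : 𝓞 F, ∃ n : ℤ, Algebra.trace ℚ F (ν * a) = n},
      cexp (2 * Real.pi * I * pairing (ν : F) z) =
        cexp (-(2 * Real.pi * B ν)) * cexp (2 * Real.pi * I * (∑ i, (e ν i : ℝ) * x₀ i : ℝ)) := by
    intro ν
    rw [← hx₀, stub_pairing_cubePoint F ν (e ν) (he ν) x₀ y, ← Complex.exp_add]
    congr 1
    ring_nf
    rw [Complex.I_sq]
    ring
  refine ⟨?_, ?_⟩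
  · -- reindex the torus expansion along `e`
    have key : HasSum ((fun n : Module.Free.ChooseBasisIndex ℤ (𝓞 F) → ℤ ↦
        (∫ x in Set.Icc (0 : Coord F) 1, g x * cexp (-(2 * Real.pi * I * (∑ i, (n i : ℝ) * x i : ℝ)))) *
          cexp (2 * Real.pi * I * (∑ i, (n i : ℝ) * x₀ i : ℝ))) ∘ e) (f z) :=
      (Equiv.hasSum_iff e).2 hsum
    refine key.congr_fun fun ν ↦ ?_
    simp only [Function.comp_apply]
    rw [hcoeff ν, hphase₀ ν]
    ring
  · have key : Summable ((fun n : Module.Free.ChooseBasisIndex ℤ (𝓞 F) → ℤ ↦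
        ‖∫ x in Set.Icc (0 : Coord F) 1, g x * cexp (-(2 * Real.pi * I * (∑ i, (n i : ℝ) * x i : ℝ)))‖) ∘ e) :=
      (Equiv.summable_iff e).2 habs
    refine key.congr fun ν ↦ ?_
    simp only [Function.comp_apply]
    rw [hcoeff ν, norm_mul, Complex.norm_exp, mul_comm]
    congr 1
    simp [hBdef, hydef]

omit [NumberField F] in
/-- A non-zero element of a totally real field which is not totally positive has a negative conjugate
(real embeddings are injective). -/
theorem exists_embedding_neg {ν : F} (hν0 : ν ≠ 0) (hnot : ¬ ∀ σ : F →+* ℝ, 0 < σ ν) :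
    ∃ φ : F →+* ℝ, φ ν < 0 := by
  push Not at hnot
  obtain ⟨σ, hσ⟩ := hnot
  refine ⟨σ, lt_of_le_of_ne hσ fun h ↦ hν0 ?_⟩
  exact (map_eq_zero σ).1 h

/-- **Götzky–Koecher ⇒ bounded at `∞`** (Freitag I.4.9 with I.4.3): for `F` totally real of degree `≥ 2`, a
holomorphic `f` on `ℍ` that is `𝓞 F`-periodic and satisfies `f(εz) = c(ε) f(z)`, `c(ε) ≠ 0`, for the totally positive
units `ε` of a finite-index subgroup `U ≤ (𝓞 F)ˣ` is bounded at `∞` (`HilbertModular.IsBoundedAtInfty`).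
[cite: Freitag1990, Ch. I Prop. 4.9] -/
theorem isBoundedAtInfty_of_unit_equivariant (F : Type) [Field F] [NumberField F]
    [NumberField.IsTotallyReal F] (hd : 1 < Module.finrank ℚ F) (f : Point F → ℂ) (hf : IsHolomorphicOn F f)
    (hper : ∀ (a : 𝓞 F) (z : Point F), z ∈ halfSpace F → f (fun σ ↦ z σ + ((σ (a : F) : ℝ) : ℂ)) = f z)
    (U : Subgroup (𝓞 F)ˣ) (hU : U.FiniteIndex) (c : (𝓞 F)ˣ → ℂ) (hc : ∀ ε ∈ U, c ε ≠ 0)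
    (hmod : ∀ ε ∈ U, (∀ σ : F →+* ℝ, 0 < σ ((ε : 𝓞 F) : F)) → ∀ z ∈ halfSpace F,
      f (fun σ ↦ ((σ ((ε : 𝓞 F) : F) : ℝ) : ℂ) * z σ) = c ε * f z) :
    IsBoundedAtInfty F f := by
  refine stub_bounded_of_coeff_support F f {ν : F | ∀ a : 𝓞 F, ∃ n : ℤ, Algebra.trace ℚ F (ν * a) = n}
    (fourierCoeff f) ?_ (fun z hz ↦ (hasSum_fourierCoeff F f hf hper z hz).1) ?_
  · intro ν hν hne
    by_contra hnot
    push Not at hnot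
    obtain ⟨hν0, hnpos⟩ := hnot
    have hnpos' : ¬ ∀ σ : F →+* ℝ, 0 < σ ν := by
      intro h; obtain ⟨σ, hσ⟩ := hnpos; exact (lt_irrefl _ ((h σ).trans_le hσ)).elim
    obtain ⟨φ, hφ⟩ := exists_embedding_neg hν0 hnpos'
    exact hne (by
      rw [fourierCoeff_eq]
      exact stub_koecher_fourierCoeffAt_eq_zero F hd f hf hper U hU c hc hmod ν hν φ hφ (fun _ ↦ 1) fun _ ↦ one_pos)
  · intro y hy
    obtain ⟨x, hx⟩ := exists_cubePoint_eq (F := F) (cubePoint (0 : Coord F) y)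
    have hz : cubePoint (0 : Coord F) y ∈ halfSpace F :=
      koe_cubePoint_mem_halfSpace 0 hy
    have h := (hasSum_fourierCoeff F f hf hper _ hz).2
    refine h.congr fun ν ↦ ?_
    simp [koe_cubePoint_im]

end Summit.Langlands.Langlands.Theorems.HilbertIntegralOverconvergentIsCongruence
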